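import Mathlib
import HarnessLib

/-!
# Route `PoloidalWindowDoor`, item `LrcModEntire` (stmt-NavierStokesRegularity-20428), cell (Q4-sonic, straight branch, μ(−1,0) < 0) —
# SEPARATED SOLUTIONS `α(s) + e(z)A(s) + g(z)` OF A LINEAR SECOND-ORDER IDENTITY: the `s`-profile solves `A″ = −λA − m`, and bounded solutions are sinusoids

Cell ns-regularity-ideate, LEAD-lineage seat ns-poloidal-K2-p3 g17 (`--supports stmt-NavierStokesRegularity-20428`; memo `Cruxes/LrcModEntire/T2B-g17.md` §2(2d),
brick B-SEP).  Class-free real analysis.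

On the sonic hot sheet the cross-web velocity is `f₂(s,z) = α(s) + e(z)A₃(s) + g(z)` (speed law + cubic transport + Huygens in time) and is harmonic in
`(s, y = d(z))` (sheet Cauchy–Riemann, `…Q4SonicSheetCR`); in the height variable this is an identity `α″(s) + e(z)A″(s) + P(z)A(s) + Q(z) = 0` on `ℝ × I`
with `z`-dependent coefficients.  This file records the two elementary consequences used in T2B-g17 §2(2d):

* `sProfile_ode_of_separated` — if `e′(z₀) ≠ 0` at some `z₀ ∈ I` then **`A″(s) = −λ·A(s) − m` for all `s`**, with the constants `λ = P′(z₀)/e′(z₀)`,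
  `m = Q′(z₀)/e′(z₀)` (differentiate the identity in `z` at `z₀`);
* `sinusoid_of_ode_of_bounded` — a bounded `C²` solution of `A″ = −λA − m` on ℝ with `λ > 0` is **`A(s) = −m/λ + c₁cos(√λ·s) + c₂sin(√λ·s)`** (energy identity
  for the difference with the explicit solution).

(The cases `λ ≤ 0` force `A` constant for bounded `A`; not needed below and not typed here.)

WHAT THIS IS NOT: not a claim about Navier–Stokes regularity and not a stub of the registry; class-free lemmas for the residual research cell `stub_Q4sonicLineNeg`
of `Cruxes/LrcModEntire/Lines/twist_split.lean` (bears_on LADDER-NS N0 via item 20428).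
-/

noncomputable section

set_option linter.dupNamespace false

namespace Summit.NavierStokesRegularity.NavierStokesRegularity.Theorems.PoloidalWindowDoorLrcModEntireSeparatedHarmonic

open Set Function Filter Topology

/-- **The `s`-profile of a separated solution solves a constant-coefficient ODE.**  If `α″(s) + e(z)·A″(s) + P(z)·A(s) + Q(z) = 0` for all `s` and all `z`
in an open set `I`, and at some `z₀ ∈ I` the coefficients are differentiable with `e′(z₀) ≠ 0`, then `A″(s) = −(P′(z₀)/e′(z₀))·A(s) − Q′(z₀)/e′(z₀)` for
every `s`.  (Here `α″, A″` are any functions standing for the second derivatives: the statement is algebraic in them.) -/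
theorem sProfile_ode_of_separated {I : Set ℝ} (hI : IsOpen I) {α₂ A A₂ e P Q : ℝ → ℝ}
    (hid : ∀ s : ℝ, ∀ z ∈ I, α₂ s + e z * A₂ s + P z * A s + Q z = 0)
    {z₀ : ℝ} (hz₀ : z₀ ∈ I) (he : DifferentiableAt ℝ e z₀) (hP : DifferentiableAt ℝ P z₀) (hQ : DifferentiableAt ℝ Q z₀)
    (he' : deriv e z₀ ≠ 0) (s : ℝ) :
    A₂ s = -(deriv P z₀ / deriv e z₀) * A s - deriv Q z₀ / deriv e z₀ := by
  -- the function `z ↦ e z * A₂ s + P z * A s + Q z` is constant (= −α₂ s) near `z₀`, so its derivative there vanishes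
  have hF : HasDerivAt (fun z => e z * A₂ s + P z * A s + Q z)
      (deriv e z₀ * A₂ s + deriv P z₀ * A s + deriv Q z₀) z₀ :=
    ((he.hasDerivAt.mul_const (A₂ s)).add (hP.hasDerivAt.mul_const (A s))).add hQ.hasDerivAt
  have hconst : (fun z => e z * A₂ s + P z * A s + Q z) =ᶠ[𝓝 z₀] fun _ => -α₂ s := by
    filter_upwards [hI.mem_nhds hz₀] with z hz
    have h := hid s z hz
    linarith
  have hzero : deriv e z₀ * A₂ s + deriv P z₀ * A s + deriv Q z₀ = 0 :=
    hF.unique ((hasDerivAt_const z₀ (-α₂ s)).congr_of_eventuallyEq hconst)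
  field_simp
  linarith

/-- Derivative of `s ↦ cos(ω s)`. -/
theorem hasDerivAt_cos_mul (ω s : ℝ) : HasDerivAt (fun x => Real.cos (ω * x)) (-Real.sin (ω * s) * ω) s := by
  have h := ((hasDerivAt_id s).const_mul ω).cos
  simpa using h

/-- Derivative of `s ↦ sin(ω s)`. -/
theorem hasDerivAt_sin_mul (ω s : ℝ) : HasDerivAt (fun x => Real.sin (ω * x)) (Real.cos (ω * s) * ω) s := by
  have h := ((hasDerivAt_id s).const_mul ω).sin
  simpa using h

/-- **Solutions of `A″ = −λA − m`, `λ > 0`, are sinusoids.**  If `A` has a derivative `A′` everywhere and `A′` has derivative `−λ·A − m` everywhere, then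
`A(s) = −m/λ + (A(0) + m/λ)·cos(√λ·s) + (A′(0)/√λ)·sin(√λ·s)` for all `s` (energy identity for the difference with the explicit solution; for `λ > 0` no
boundedness is needed — every solution is a sinusoid). -/
theorem sinusoid_of_ode {A A' : ℝ → ℝ} {lam m : ℝ} (hlam : 0 < lam)
    (hA : ∀ s, HasDerivAt A (A' s) s) (hA' : ∀ s, HasDerivAt A' (-lam * A s - m) s) (s : ℝ) :
    A s = -m / lam + (A 0 + m / lam) * Real.cos (Real.sqrt lam * s) + (A' 0 / Real.sqrt lam) * Real.sin (Real.sqrt lam * s) := by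
  set ω : ℝ := Real.sqrt lam with hω
  have hω0 : 0 < ω := Real.sqrt_pos.2 hlam
  have hωne : ω ≠ 0 := hω0.ne'
  have hω2 : ω ^ 2 = lam := Real.sq_sqrt hlam.le
  have hl : lam ≠ 0 := hlam.ne'
  -- abbreviations (plain terms, no local definitions)
  -- E x  = -m/lam + c₁ cos(ωx) + c₂ sin(ωx),  E' x = -(c₁ ω) sin(ωx) + (c₂ ω) cos(ωx),  c₁ = A 0 + m/lam, c₂ = A' 0/ω
  have hEd : ∀ x, HasDerivAt (fun x => -m / lam + (A 0 + m / lam) * Real.cos (ω * x) + (A' 0 / ω) * Real.sin (ω * x))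
      (-((A 0 + m / lam) * ω) * Real.sin (ω * x) + A' 0 * Real.cos (ω * x)) x := by
    intro x
    have h := ((hasDerivAt_const x (-m / lam)).add ((hasDerivAt_cos_mul ω x).const_mul (A 0 + m / lam))).add
      ((hasDerivAt_sin_mul ω x).const_mul (A' 0 / ω))
    refine h.congr_deriv ?_
    field_simp
    ring
  have hE'd : ∀ x, HasDerivAt (fun x => -((A 0 + m / lam) * ω) * Real.sin (ω * x) + A' 0 * Real.cos (ω * x))
      (-lam * (-m / lam + (A 0 + m / lam) * Real.cos (ω * x) + (A' 0 / ω) * Real.sin (ω * x)) - m) x := by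
    intro x
    have h := ((hasDerivAt_sin_mul ω x).const_mul (-((A 0 + m / lam) * ω))).add ((hasDerivAt_cos_mul ω x).const_mul (A' 0))
    refine h.congr_deriv ?_
    rw [← hω2]
    field_simp
    ring
  -- the difference `B = A − E` solves the homogeneous equation with zero data at `0`
  have hBd : ∀ x, HasDerivAt (fun x => A x - (-m / lam + (A 0 + m / lam) * Real.cos (ω * x) + (A' 0 / ω) * Real.sin (ω * x)))
      (A' x - (-((A 0 + m / lam) * ω) * Real.sin (ω * x) + A' 0 * Real.cos (ω * x))) x := fun x => (hA x).sub (hEd x)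
  have hB'd : ∀ x, HasDerivAt (fun x => A' x - (-((A 0 + m / lam) * ω) * Real.sin (ω * x) + A' 0 * Real.cos (ω * x)))
      (-lam * (A x - (-m / lam + (A 0 + m / lam) * Real.cos (ω * x) + (A' 0 / ω) * Real.sin (ω * x)))) x := by
    intro x
    refine ((hA' x).sub (hE'd x)).congr_deriv ?_
    ring
  -- the energy `W = B′² + λB²` has zero derivative, hence is constant
  have hWd : ∀ x, HasDerivAt (fun x =>
      (A' x - (-((A 0 + m / lam) * ω) * Real.sin (ω * x) + A' 0 * Real.cos (ω * x))) ^ 2 +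
        lam * (A x - (-m / lam + (A 0 + m / lam) * Real.cos (ω * x) + (A' 0 / ω) * Real.sin (ω * x))) ^ 2) 0 x := by
    intro x
    refine (((hB'd x).pow 2).add (((hBd x).pow 2).const_mul lam)).congr_deriv ?_
    push_cast
    ring
  have hdiffW : Differentiable ℝ (fun x =>
      (A' x - (-((A 0 + m / lam) * ω) * Real.sin (ω * x) + A' 0 * Real.cos (ω * x))) ^ 2 +
        lam * (A x - (-m / lam + (A 0 + m / lam) * Real.cos (ω * x) + (A' 0 / ω) * Real.sin (ω * x))) ^ 2) :=
    fun x => (hWd x).differentiableAt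
  have hWs := is_const_of_deriv_eq_zero hdiffW (fun x => (hWd x).deriv) s 0
  -- at `0` the energy vanishes
  simp only [mul_zero, Real.cos_zero, Real.sin_zero, mul_one, add_zero] at hWs
  have hW0 : (A' 0 - (0 + A' 0)) ^ 2 + lam * (A 0 - (-m / lam + (A 0 + m / lam))) ^ 2 = 0 := by
    field_simp
    ring
  rw [hW0] at hWs
  -- hence the difference vanishes at `s`
  have h1 : lam * (A s - (-m / lam + (A 0 + m / lam) * Real.cos (ω * s) + (A' 0 / ω) * Real.sin (ω * s))) ^ 2 = 0 := by
    nlinarith [sq_nonneg (A' s - (-((A 0 + m / lam) * ω) * Real.sin (ω * s) + A' 0 * Real.cos (ω * s))),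
      mul_nonneg hlam.le (sq_nonneg (A s - (-m / lam + (A 0 + m / lam) * Real.cos (ω * s) + (A' 0 / ω) * Real.sin (ω * s))))]
  have h2 : (A s - (-m / lam + (A 0 + m / lam) * Real.cos (ω * s) + (A' 0 / ω) * Real.sin (ω * s))) ^ 2 = 0 :=
    (mul_eq_zero.1 h1).resolve_left hl
  have h3 := pow_eq_zero_iff (two_ne_zero) |>.1 h2
  linarith

/-! ### Appendix (LEAD g17, T2B-g17 §7 S3(d)): the cases `λ ≤ 0` — bounded solutions are constant -/

/-- A function with identically zero derivative on ℝ is constant (pointwise `HasDerivAt` form). -/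
theorem const_of_hasDerivAt_zero {F : ℝ → ℝ} (h : ∀ s, HasDerivAt F 0 s) (s : ℝ) : F s = F 0 :=
  is_const_of_deriv_eq_zero (fun x => (h x).differentiableAt) (fun x => (h x).deriv) s 0

/-- **Case `λ = 0`**: a bounded solution of `A″ = −m` on ℝ is constant (and `m = 0`). -/
theorem const_of_ode_zero_bounded {A A' : ℝ → ℝ} {m M : ℝ}
    (hA : ∀ s, HasDerivAt A (A' s) s) (hA' : ∀ s, HasDerivAt A' (-m) s) (hbdd : ∀ s, |A s| ≤ M) (s : ℝ) :
    A s = A 0 := by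
  -- `A′ s = A′ 0 − m s` and `A s = A 0 + A′(0) s − m s²/2`
  have hlin : ∀ c y : ℝ, HasDerivAt (fun x : ℝ => c * x) c y := fun c y => by
    simpa using (hasDerivAt_id y).const_mul c
  have h1 : ∀ x, A' x = A' 0 - m * x := by
    intro x
    have hd : ∀ y, HasDerivAt (fun y => A' y + m * y) 0 y := by
      intro y
      have := (hA' y).add (hlin m y)
      rwa [neg_add_cancel] at this
    have := const_of_hasDerivAt_zero hd x
    simp only [mul_zero, add_zero] at this
    linarith
  have h2 : ∀ x, A x = A 0 + A' 0 * x - m * x ^ 2 / 2 := by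
    intro x
    have hd : ∀ y, HasDerivAt (fun y => A y - A' 0 * y + m * y ^ 2 / 2) 0 y := by
      intro y
      have hy2 : HasDerivAt (fun y : ℝ => m * y ^ 2 / 2) (m * y) y := by
        have h := ((hasDerivAt_pow 2 y).const_mul m).div_const 2
        exact h.congr_deriv (by push_cast; ring)
      have := ((hA y).sub (hlin (A' 0) y)).add hy2
      exact this.congr_deriv (by rw [h1 y]; ring)
    have := const_of_hasDerivAt_zero hd x
    simp only [mul_zero, sub_zero, ne_eq, OfNat.ofNat_ne_zero, not_false_eq_true, zero_pow, zero_div, add_zero] at this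
    linarith
  -- boundedness of the even part kills `m`
  have hM : 0 ≤ M := le_trans (abs_nonneg _) (hbdd 0)
  have hm : m = 0 := by
    by_contra hm
    have hmpos : 0 < |m| := abs_pos.2 hm
    -- at `x` with `x² = (2M + 2|A 0| + 1)/|m|`: `|A x + A(−x)| = |2 A 0 − m x²| ≥ |m| x² − 2|A 0| > 2M`
    set x : ℝ := Real.sqrt ((2 * M + 2 * |A 0| + 1) / |m|) with hx
    have hx2 : x ^ 2 = (2 * M + 2 * |A 0| + 1) / |m| := by
      rw [hx, Real.sq_sqrt]; positivity
    have hsum : A x + A (-x) = 2 * A 0 - m * x ^ 2 := by rw [h2 x, h2 (-x)]; ring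
    have hb : |A x + A (-x)| ≤ 2 * M := by
      have := abs_add_le (A x) (A (-x)); linarith [hbdd x, hbdd (-x)]
    rw [hsum] at hb
    have hmx : |m| * x ^ 2 = 2 * M + 2 * |A 0| + 1 := by rw [hx2]; field_simp
    have : |m * x ^ 2| ≤ |2 * A 0 - m * x ^ 2| + |2 * A 0| := by
      have := abs_sub_abs_le_abs_sub (m * x ^ 2) (2 * A 0)
      rw [abs_sub_comm (m * x ^ 2) (2 * A 0)] at this
      linarith
    rw [abs_mul, abs_of_nonneg (sq_nonneg x), hmx] at this
    have h20 : |2 * A 0| = 2 * |A 0| := by rw [abs_mul]; simp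
    linarith
  -- then the odd part kills `A′ 0`
  have hslope : A' 0 = 0 := by
    by_contra hq
    have hqpos : 0 < |A' 0| := abs_pos.2 hq
    set x : ℝ := (2 * M + 1) / A' 0 with hx
    have hdiff : A x - A (-x) = 2 * A' 0 * x := by rw [h2 x, h2 (-x)]; ring
    have hb : |A x - A (-x)| ≤ 2 * M := by
      have := abs_sub (A x) (A (-x)); linarith [hbdd x, hbdd (-x)]
    rw [hdiff, hx] at hb
    have e : 2 * A' 0 * ((2 * M + 1) / A' 0) = 2 * (2 * M + 1) := by field_simp
    rw [e, abs_of_nonneg (by linarith)] at hb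
    linarith
  rw [h2 s, hm, hslope]; ring

/-- **Case `λ < 0`**: a bounded solution of `A″ = −λA − m` on ℝ with `λ < 0` is constant (equal to `−m/λ`): exponential dichotomy. -/
theorem const_of_ode_neg_bounded {A A' : ℝ → ℝ} {lam m M : ℝ} (hlam : lam < 0)
    (hA : ∀ s, HasDerivAt A (A' s) s) (hA' : ∀ s, HasDerivAt A' (-lam * A s - m) s) (hbdd : ∀ s, |A s| ≤ M) (s : ℝ) :
    A s = -m / lam := by
  have hl : lam ≠ 0 := hlam.ne
  set κ : ℝ := Real.sqrt (-lam) with hκ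
  have hκ0 : 0 < κ := Real.sqrt_pos.2 (by linarith)
  have hκ2 : κ ^ 2 = -lam := Real.sq_sqrt (by linarith)
  -- `B := A + m/lam` solves `B″ = κ² B`
  have hB : ∀ x, HasDerivAt (fun y => A y + m / lam) (A' x) x := fun x => by
    simpa using (hA x).add_const (m / lam)
  have hB' : ∀ x, HasDerivAt (fun y => A' y) (κ ^ 2 * (A x + m / lam)) x := by
    intro x
    have := hA' x
    rw [hκ2]
    refine this.congr_deriv ?_
    field_simp
    ring
  -- `C := A′ − κ B` decays: `(C·e^{κ y})′ = 0`;  `D := A′ + κ B` grows: `(D·e^{−κ y})′ = 0`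
  have hC : ∀ x, (A' x - κ * (A x + m / lam)) * Real.exp (κ * x) = (A' 0 - κ * (A 0 + m / lam)) := by
    intro x
    have hd : ∀ y, HasDerivAt (fun y => (A' y - κ * (A y + m / lam)) * Real.exp (κ * y)) 0 y := by
      intro y
      have he : HasDerivAt (fun y => Real.exp (κ * y)) (Real.exp (κ * y) * κ) y := by
        simpa using ((hasDerivAt_id y).const_mul κ).exp
      have := (((hB' y).sub ((hB y).const_mul κ)).mul he)
      exact this.congr_deriv (by simp only [Pi.sub_apply]; ring)
    have := const_of_hasDerivAt_zero hd x
    simpa using this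
  have hD : ∀ x, (A' x + κ * (A x + m / lam)) * Real.exp (-(κ * x)) = (A' 0 + κ * (A 0 + m / lam)) := by
    intro x
    have hd : ∀ y, HasDerivAt (fun y => (A' y + κ * (A y + m / lam)) * Real.exp (-(κ * y))) 0 y := by
      intro y
      have he : HasDerivAt (fun y => Real.exp (-(κ * y))) (Real.exp (-(κ * y)) * (-κ)) y := by
        simpa using (((hasDerivAt_id y).const_mul κ).neg).exp
      have := (((hB' y).add ((hB y).const_mul κ)).mul he)
      exact this.congr_deriv (by simp only [Pi.add_apply]; ring)
    have := const_of_hasDerivAt_zero hd x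
    simpa using this
  -- boundedness of `B` forces both constants to vanish
  set c₁ : ℝ := A' 0 - κ * (A 0 + m / lam) with hc₁
  set c₂ : ℝ := A' 0 + κ * (A 0 + m / lam) with hc₂
  have hBform : ∀ x, 2 * κ * (A x + m / lam) = c₂ * Real.exp (κ * x) - c₁ * Real.exp (-(κ * x)) := by
    intro x
    have h1 := hC x
    have h2 := hD x
    have hpos := Real.exp_pos (κ * x)
    have hneg := Real.exp_pos (-(κ * x))
    -- divide `h1` by `e^{κx}` and `h2` by `e^{−κx}`
    have e1 : A' x - κ * (A x + m / lam) = c₁ * Real.exp (-(κ * x)) := by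
      rw [Real.exp_neg, ← div_eq_mul_inv, eq_div_iff hpos.ne', h1]
    have e2 : A' x + κ * (A x + m / lam) = c₂ * Real.exp (κ * x) := by
      rw [show Real.exp (κ * x) = (Real.exp (-(κ * x)))⁻¹ by rw [Real.exp_neg, inv_inv], ← div_eq_mul_inv,
        eq_div_iff hneg.ne', h2]
    linarith
  have hMB : ∀ x, |2 * κ * (A x + m / lam)| ≤ 2 * κ * (M + |m / lam|) := by
    intro x
    rw [abs_mul, abs_of_pos (by positivity : (0 : ℝ) < 2 * κ)]
    gcongr
    exact (abs_add_le _ _).trans (by linarith [hbdd x])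
  set K : ℝ := 2 * κ * (M + |m / lam|) with hK
  have hM : 0 ≤ M := le_trans (abs_nonneg _) (hbdd 0)
  have hK0 : 0 ≤ K := by rw [hK]; exact mul_nonneg (by positivity) (by linarith [abs_nonneg (m / lam)])
  -- `c₂ = 0`: otherwise `c₂ e^{κx}` dominates for large `x`
  have hc2 : c₂ = 0 := by
    by_contra h2
    have h2pos : 0 < |c₂| := abs_pos.2 h2
    set x : ℝ := (K + |c₁| + 1) / (|c₂| * κ) with hx
    have hx0 : 0 ≤ x := by rw [hx]; exact div_nonneg (by linarith [abs_nonneg c₁]) (mul_pos h2pos hκ0).le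
    have hexp : K + |c₁| + 1 ≤ |c₂| * Real.exp (κ * x) := by
      have hkx : κ * x = (K + |c₁| + 1) / |c₂| := by rw [hx]; field_simp
      have h := Real.add_one_le_exp ((K + |c₁| + 1) / |c₂|)
      have h' := mul_le_mul_of_nonneg_left h (abs_nonneg c₂)
      rw [show |c₂| * ((K + |c₁| + 1) / |c₂| + 1) = K + |c₁| + 1 + |c₂| by field_simp] at h'
      rw [hkx]
      linarith [abs_nonneg c₂]
    have hsmall : |c₁ * Real.exp (-(κ * x))| ≤ |c₁| := by
      rw [abs_mul, abs_of_pos (Real.exp_pos _)]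
      apply mul_le_of_le_one_right (abs_nonneg _)
      rw [Real.exp_le_one_iff]; nlinarith
    have hb := hMB x
    rw [hBform x] at hb
    have : |c₂ * Real.exp (κ * x)| ≤ |c₂ * Real.exp (κ * x) - c₁ * Real.exp (-(κ * x))| + |c₁ * Real.exp (-(κ * x))| := by
      have := abs_sub_abs_le_abs_sub (c₂ * Real.exp (κ * x)) (c₁ * Real.exp (-(κ * x)))
      linarith
    rw [abs_mul c₂, abs_of_pos (Real.exp_pos _)] at this
    linarith
  -- `c₁ = 0`: otherwise `c₁ e^{−κx}` dominates for large negative `x`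
  have hc1 : c₁ = 0 := by
    by_contra h1
    have h1pos : 0 < |c₁| := abs_pos.2 h1
    set x : ℝ := -((K + 1) / (|c₁| * κ)) with hx
    have hexp : K + 1 ≤ |c₁| * Real.exp (-(κ * x)) := by
      have hkx : -(κ * x) = (K + 1) / |c₁| := by rw [hx]; field_simp
      have h := Real.add_one_le_exp ((K + 1) / |c₁|)
      have h' := mul_le_mul_of_nonneg_left h (abs_nonneg c₁)
      rw [show |c₁| * ((K + 1) / |c₁| + 1) = K + 1 + |c₁| by field_simp] at h'
      rw [hkx]
      linarith [abs_nonneg c₁]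
    have hb := hMB x
    rw [hBform x, hc2, zero_mul, zero_sub, abs_neg, abs_mul, abs_of_pos (Real.exp_pos _)] at hb
    linarith
  have h := hBform s
  rw [hc1, hc2, zero_mul, zero_mul, sub_zero] at h
  have h' : A s + m / lam = 0 := by
    rcases mul_eq_zero.1 h with h1 | h1
    · exfalso
      rcases mul_eq_zero.1 h1 with h2 | h2
      · norm_num at h2
      · exact hκ0.ne' h2
    · exact h1
  rw [neg_div]
  linarith

end Summit.NavierStokesRegularity.NavierStokesRegularity.Theorems.PoloidalWindowDoorLrcModEntireSeparatedHarmonic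

end
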